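import Summits.BirchSwinnertonDyer.BirchSwinnertonDyer.Theorems.ResidualThetaTransportAtTwoThetaLayerLambdaCongruenceAtTwoCuspSpanFourInvariance
import Summits.BirchSwinnertonDyer.BirchSwinnertonDyer.Theorems.ResidualThetaTransportAtTwoThetaLayerLambdaCongruenceAtTwoCuspSpanSafePrimes
import Summits.BirchSwinnertonDyer.BirchSwinnertonDyer.Theorems.ResidualThetaTransportAtTwoThetaLayerLambdaCongruenceAtTwoCuspSpanSignCompanion
import Summits.BirchSwinnertonDyer.BirchSwinnertonDyer.Theorems.ResidualThetaTransportAtTwoThetaLayerLambdaCongruenceAtTwoCuspSpanDescentEngine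
import HarnessLib

/-!
# Route `ResidualThetaTransportAtTwo`, cruxes Kan⁺ (stmt-BirchSwinnertonDyer-20688) / node 27436 / 21437: **4-INVARIANCE of the
# `B₁`-character at EVERY ODD LEVEL** (`F(u) = F(−4/u)`, `F(4u) = F(u)`)

Cell `bsd-wall`, width seat `bsd-wall-rtt-p3-w5` g2 (2026-08-28), lane «two-fold `B₁`-products at every odd level»; the lead's
(rtt-p3 g9) successor item (2). THEOREMS ONLY (no `def`, no `sorry`); `--supports stmt-BirchSwinnertonDyer-20688`. BSD is not proved
by this; the node `CuspSpanEvenAtTwo N` stays a hypothesis at every level not covered by a certificate.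

SETTING (as in `…CuspSpanGenerationB1`, `…CuspSpanFourInvariance`): `χ : Γ₀(N) → ZMod 2` additive, killing the small-trace elements
and the elements with lower-right entry `±4^k`, `k ≥ 1`; `F(u) := χ(β)` for `b(β) = −1`, `d(β) ≡ u`. The lead's THEOREM 2 of
`…CuspSpanFourInvariance` proves `F(u) = F(−4/u)` at PRIME level from one Dirichlet prime. Here the SAME matrix argument runs at every
ODD level `N`, the arithmetic input «`g ≡ u (mod N)`, `g ∣ 4^k − 1`, `4^k ≡ 4 (mod N)`» being `exists_modEq_dvd_four_pow_sub_one` of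
`…CuspSpanSafePrimes` (a product of two or three safe Dirichlet primes, CRT, Fermat, Euler).

* `chi_eq_of_b_neg_one_of_mul_d_eq_neg_four_odd`: **`F(u) = F(−4/u)`** — with `α₁ g + κ₁ N = 1`, `4^k − 1 = g m₀`, the product of
  `β₁ := (α₁, −1; Nκ₁, g)` and `β₂ := (α₂, −1; Nκ₂, δ₂)`, `δ₂ := −m₀ − α₁`, has lower-right entry exactly `−4^k`.
* `chi_eq_of_b_neg_one_of_d_eq_four_mul_odd`: **`F(4u) = F(u)`** (`u ↦ −4/u ↦ −1/(−4/u) = u/4`); `E_of_eq_four_mul_odd` (`K/E` form).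
* §2 (with the sign companion `…CuspSpanSignCompanion`, whose 4-invariance hypothesis is now discharged): **`F(−u) = F(u)`**
  (`chi_eq_of_b_neg_one_of_d_eq_neg_odd`), **`F(1/u) = F(u)`** (`chi_eq_of_b_neg_one_of_mul_d_eq_one_odd`), `F(4^j u) = F(u)`, and the
  `K/E` forms `E_of_eq_neg_odd`, `E_of_mul_eq_one_odd`, `K_of_K_four_odd`, `K_of_K_four'_odd`, `K_of_K_neg_odd`, `K_of_K_inv_odd` —
  unconditionally at EVERY ODD level (the prime-level certificate generator `gencert2.py` runs at any odd level by renaming). So at every odd level the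
  `B₁`-character is constant on the orbits of the group generated by `u ↦ 4u`, `u ↦ −u`, `u ↦ 1/u`.

CONSEQUENCES (line `birth`): the orbit-certificate calculus of `…CuspSpanKECalculus` (one seed per orbit of `u ↦ 4u`, `u ↦ −1/u`)
and the sign companion `…CuspSpanSignCompanion` (`F(−u) = F(u)`, `F(1/u) = F(u)` given 4-invariance) now apply at every odd level,
in particular at prime-power levels `p^e` where the `B₁`-descent `chi_eq_zero_of_forall_b1` holds; for composite `N` they feed the
descent tables / row engine of rtt-p3-w2 (`…CuspSpanDescentEngine`).

References: P. G. L. Dirichlet (1837) / Mathlib `PrimesInAP`; H. Rademacher, Abh. Math. Sem. Hamburg 7 (1929) §1 [Rademacher1929];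
A. W. Knapp, *Elliptic curves* (1992) Prop. 11.1 [Knapp1993]; R. Pollack, Duke Math. J. 118 (2003) Conj. 6.3 [Pollack2003].
-/

set_option autoImplicit false
set_option linter.dupNamespace false

open scoped MatrixGroups

open CongruenceSubgroup

namespace Summit.BirchSwinnertonDyer.BirchSwinnertonDyer.Theorems.SignedMuAtTwo


/-! ## `F(u) = F(−4/u)` and `F(4u) = F(u)` at every odd level -/

section OddLevel

variable {N : ℕ} {χ : Gamma0 N → ZMod 2}

/-- **`F(u) = F(−4/u)` at every odd level.** For `b = −1` elements `β, β'` of `Γ₀(N)`, `N` odd, with `d(β) d(β') ≡ −4 (mod N)`: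
`χ β = χ β'`. With `g ≡ d(β) (mod N)`, `g ∣ 4^k − 1 = g m₀`, `4^k ≡ 4 (mod N)` (`…CuspSpanSafePrimes`) and `α₁ g + κ₁ N = 1`, the product of
`β₁ := (α₁, −1; Nκ₁, g)` and `β₂ := (α₂, −1; Nκ₂, δ₂)`, `δ₂ := −m₀ − α₁`, has lower-right entry exactly `−4^k`, so
`χ β₁ = χ β₂`, while `d(β₁) ≡ d(β)` and `d(β) d(β₂) ≡ −4^k ≡ −4`. [cite: Pollack2003, Conj. 6.3] -/
theorem chi_eq_of_b_neg_one_of_mul_d_eq_neg_four_odd (hN : Odd N)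
    (hadd : ∀ γ δ : Gamma0 N, χ (γ * δ) = χ γ + χ δ)
    (hsmall : ∀ γ : Gamma0 N, ((γ : SL(2, ℤ)) 0 0 + (γ : SL(2, ℤ)) 1 1).natAbs ≤ 2 → χ γ = 0)
    (hkill : ∀ γ : Gamma0 N, (∃ k : ℕ, 1 ≤ k ∧ ((γ : SL(2, ℤ)) 1 1).natAbs = 4 ^ k) → χ γ = 0)
    {β β' : Gamma0 N} (hb : (β : SL(2, ℤ)) 0 1 = -1) (hb' : (β' : SL(2, ℤ)) 0 1 = -1)
    (h : ((((β : SL(2, ℤ)) 1 1 : ℤ) : ZMod N)) * ((((β' : SL(2, ℤ)) 1 1 : ℤ) : ZMod N)) = -4) :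
    χ β = χ β' := by
  haveI : NeZero N := ⟨hN.pos.ne'⟩
  set d : ℤ := (β : SL(2, ℤ)) 1 1 with hd
  have hdu : IsUnit ((d : ℤ) : ZMod N) := isUnit_gamma0_apply_one_one β
  set b : ℕ := ((d : ℤ) : ZMod N).val with hbdef
  have hbcop : b.Coprime N := by
    have h := ZMod.val_coe_unit_coprime hdu.unit
    rwa [IsUnit.unit_spec] at h
  obtain ⟨g, k, hg, hk1, hgb, hgdvd, h4k⟩ := exists_modEq_dvd_four_pow_sub_one hN hbcop
  obtain ⟨m₀, hm₀⟩ := hgdvd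
  -- Bezout for `(g, N)` and the element `β₁ = (α₁, −1; Nκ₁, g)`
  have hgcop : Nat.Coprime g N := by
    unfold Nat.Coprime; rw [hgb.gcd_eq]; exact hbcop
  obtain ⟨α₁, κ₁, h1⟩ : IsCoprime (g : ℤ) (N : ℤ) := Nat.isCoprime_iff_coprime.mpr hgcop
  obtain ⟨β₁, -, h101, h110, h111⟩ := ThetaLayerLambdaCongruenceAtTwo.exists_gamma0_entries (N := N)
    α₁ (-1) (N * κ₁) g (by linear_combination h1) (dvd_mul_right _ _)
  -- `δ₂ := −m₀ − α₁` is prime to `N` since `g δ₂ = −4^k + κ₁ N`; the element `β₂ = (α₂, −1; Nκ₂, δ₂)`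
  set δ₂ : ℤ := -m₀ - α₁ with hδ₂
  have hgδ : (g : ℤ) * δ₂ = -4 ^ k + κ₁ * N := by
    rw [hδ₂]; linear_combination hm₀ - h1
  have hcop4 : IsCoprime ((4 : ℤ) ^ k) N := by
    apply IsCoprime.pow_left
    rw [show (4 : ℤ) = ((4 : ℕ) : ℤ) by norm_num, Nat.isCoprime_iff_coprime]
    simpa using (Nat.coprime_two_left.mpr hN).pow_left 2
  have hcopδ : IsCoprime δ₂ (N : ℤ) := by
    have e1 : IsCoprime ((g : ℤ) * δ₂) N := by
      rw [hgδ]; exact (hcop4.neg_left).add_mul_right_left κ₁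
    exact e1.of_mul_left_right
  obtain ⟨α₂, κ₂, h2⟩ := hcopδ
  obtain ⟨β₂, -, h201, -, h211⟩ := ThetaLayerLambdaCongruenceAtTwo.exists_gamma0_entries (N := N)
    α₂ (-1) (N * κ₂) δ₂ (by linear_combination h2) (dvd_mul_right _ _)
  -- the product has lower-right entry `−4^k`, so `χ β₁ = χ β₂`
  have hprod : ((β₁ * β₂ : Gamma0 N) : SL(2, ℤ)) 1 1 = -4 ^ k := by
    rw [gamma0_mul_apply_one_one', h110, h201, h111, h211]; linear_combination hgδ
  have hkilled : χ (β₁ * β₂) = 0 :=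
    hkill _ ⟨k, hk1, by rw [hprod, Int.natAbs_neg, Int.natAbs_pow]; rfl⟩
  have h12 : χ β₁ = χ β₂ := by
    rw [hadd] at hkilled
    have e1 : χ β₁ = -χ β₂ := by linear_combination hkilled
    rw [e1, ZMod.neg_eq_self_mod_two]
  -- residues: `d(β₁) ≡ d(β)` and `d(β) d(β₂) ≡ −4 ≡ d(β) d(β')`
  have hgb' : (g : ZMod N) = (b : ZMod N) := (ZMod.natCast_eq_natCast_iff _ _ _).mpr hgb
  have hres1 : ((((β₁ : SL(2, ℤ)) 1 1 : ℤ) : ZMod N)) = ((d : ℤ) : ZMod N) := by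
    rw [h111, Int.cast_natCast, hgb', hbdef, ZMod.natCast_zmod_val]
  have hres2 : ((d : ℤ) : ZMod N) * (((δ₂ : ℤ) : ZMod N)) = -4 := by
    rw [← hres1, h111]
    have e1 := congrArg (Int.cast : ℤ → ZMod N) hgδ
    push_cast at e1 ⊢
    rw [e1, h4k, ZMod.natCast_self, mul_zero, add_zero]
  have hres3 : ((((β' : SL(2, ℤ)) 1 1 : ℤ) : ZMod N)) = ((((β₂ : SL(2, ℤ)) 1 1 : ℤ) : ZMod N)) := by
    rw [h211]
    exact hdu.mul_left_cancel (h.trans hres2.symm)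
  rw [chi_eq_of_apply_zero_one_eq_neg_one hadd hsmall hb h101 hres1.symm, h12,
    ← chi_eq_of_apply_zero_one_eq_neg_one hadd hsmall hb' h201 hres3]

/-- **`F(4u) = F(u)` at every odd level.** For `b = −1` elements of `Γ₀(N)`, `N` odd, with `d(β) ≡ 4 d(β') (mod N)`: `χ β = χ β'`
(`u ↦ −4/u ↦ −1/(−4/u) = u/4`). [cite: Pollack2003, Conj. 6.3] -/
theorem chi_eq_of_b_neg_one_of_d_eq_four_mul_odd (hN : Odd N)
    (hadd : ∀ γ δ : Gamma0 N, χ (γ * δ) = χ γ + χ δ)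
    (hsmall : ∀ γ : Gamma0 N, ((γ : SL(2, ℤ)) 0 0 + (γ : SL(2, ℤ)) 1 1).natAbs ≤ 2 → χ γ = 0)
    (hkill : ∀ γ : Gamma0 N, (∃ k : ℕ, 1 ≤ k ∧ ((γ : SL(2, ℤ)) 1 1).natAbs = 4 ^ k) → χ γ = 0)
    {β β' : Gamma0 N} (hb : (β : SL(2, ℤ)) 0 1 = -1) (hb' : (β' : SL(2, ℤ)) 0 1 = -1)
    (h : ((((β : SL(2, ℤ)) 1 1 : ℤ) : ZMod N)) = 4 * ((((β' : SL(2, ℤ)) 1 1 : ℤ) : ZMod N))) :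
    χ β = χ β' := by
  haveI : NeZero N := ⟨hN.pos.ne'⟩
  have hu := isUnit_gamma0_apply_one_one β'
  obtain ⟨β₁, hb1, hd1⟩ := exists_b_neg_one_of_isUnit (N := N) (hu.unit⁻¹).isUnit.neg
  have e1 : ((((β : SL(2, ℤ)) 1 1 : ℤ) : ZMod N)) * ((((β₁ : SL(2, ℤ)) 1 1 : ℤ) : ZMod N)) = -4 := by
    rw [h, hd1, mul_neg, mul_assoc, IsUnit.mul_val_inv, mul_one]
  have e2 : ((((β₁ : SL(2, ℤ)) 1 1 : ℤ) : ZMod N)) * ((((β' : SL(2, ℤ)) 1 1 : ℤ) : ZMod N)) = -1 := by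
    rw [hd1, neg_mul, IsUnit.val_inv_mul]
  rw [chi_eq_of_b_neg_one_of_mul_d_eq_neg_four_odd hN hadd hsmall hkill hb hb1 e1,
    chi_eq_of_b_neg_one_of_mul_d_eq_neg_one hadd hsmall hb1 hb' e2]

/-- `E(r, s)` from `r = 4 s` at every odd level (`K/E` form for the certificate calculus of `…CuspSpanKECalculus`).
[cite: Pollack2003, Conj. 6.3] -/
theorem E_of_eq_four_mul_odd (hN : Odd N) (hadd : ∀ γ δ : Gamma0 N, χ (γ * δ) = χ γ + χ δ)
    (hsmall : ∀ γ : Gamma0 N, ((γ : SL(2, ℤ)) 0 0 + (γ : SL(2, ℤ)) 1 1).natAbs ≤ 2 → χ γ = 0)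
    (hkill : ∀ γ : Gamma0 N, (∃ k : ℕ, 1 ≤ k ∧ ((γ : SL(2, ℤ)) 1 1).natAbs = 4 ^ k) → χ γ = 0)
    (r s : ZMod N) (h : r = 4 * s) :
    ∀ β β' : Gamma0 N, (β : SL(2, ℤ)) 0 1 = -1 → (β' : SL(2, ℤ)) 0 1 = -1 →
      ((((β : SL(2, ℤ)) 1 1 : ℤ) : ZMod N)) = r → ((((β' : SL(2, ℤ)) 1 1 : ℤ) : ZMod N)) = s → χ β = χ β' :=
  fun _ _ hb hb' hd hd' ↦ chi_eq_of_b_neg_one_of_d_eq_four_mul_odd hN hadd hsmall hkill hb hb' (by rw [hd, hd', h])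

end OddLevel

/-! ## §2. The sign companion at every odd level: `F(−u) = F(u)`, `F(1/u) = F(u)`, `F(4^j u) = F(u)` -/

section SignOdd

variable {N : ℕ} {χ : Gamma0 N → ZMod 2}

/-- **`F(4^j u) = F(u)` at every odd level.** [cite: Pollack2003, Conj. 6.3] -/
theorem chi_eq_of_b_neg_one_of_d_eq_four_pow_mul_odd (hN : Odd N)
    (hadd : ∀ γ δ : Gamma0 N, χ (γ * δ) = χ γ + χ δ)
    (hsmall : ∀ γ : Gamma0 N, ((γ : SL(2, ℤ)) 0 0 + (γ : SL(2, ℤ)) 1 1).natAbs ≤ 2 → χ γ = 0)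
    (hkill : ∀ γ : Gamma0 N, (∃ k : ℕ, 1 ≤ k ∧ ((γ : SL(2, ℤ)) 1 1).natAbs = 4 ^ k) → χ γ = 0)
    (j : ℕ) {β β' : Gamma0 N} (hb : (β : SL(2, ℤ)) 0 1 = -1) (hb' : (β' : SL(2, ℤ)) 0 1 = -1)
    (h : ((((β : SL(2, ℤ)) 1 1 : ℤ) : ZMod N)) = 4 ^ j * ((((β' : SL(2, ℤ)) 1 1 : ℤ) : ZMod N))) :
    χ β = χ β' :=
  haveI : NeZero N := ⟨hN.pos.ne'⟩
  chi_eq_of_b_neg_one_of_d_eq_four_pow_mul_of_four hadd hsmall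
    (fun _ _ hb₁ hb₂ e ↦ chi_eq_of_b_neg_one_of_d_eq_four_mul_odd hN hadd hsmall hkill hb₁ hb₂ e) j hb hb' h

/-- **`F(−u) = F(u)` at every odd level.** For `b = −1` elements of `Γ₀(N)`, `N` odd, with `d(β) ≡ −d(β') (mod N)`: `χ β = χ β'`
(`…CuspSpanSignCompanion` Thm 3, its 4-invariance hypothesis discharged by `chi_eq_of_b_neg_one_of_d_eq_four_mul_odd`).
[cite: Pollack2003, Conj. 6.3] -/
theorem chi_eq_of_b_neg_one_of_d_eq_neg_odd (hN : Odd N)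
    (hadd : ∀ γ δ : Gamma0 N, χ (γ * δ) = χ γ + χ δ)
    (hsmall : ∀ γ : Gamma0 N, ((γ : SL(2, ℤ)) 0 0 + (γ : SL(2, ℤ)) 1 1).natAbs ≤ 2 → χ γ = 0)
    (hkill : ∀ γ : Gamma0 N, (∃ k : ℕ, 1 ≤ k ∧ ((γ : SL(2, ℤ)) 1 1).natAbs = 4 ^ k) → χ γ = 0)
    {β β' : Gamma0 N} (hb : (β : SL(2, ℤ)) 0 1 = -1) (hb' : (β' : SL(2, ℤ)) 0 1 = -1)
    (h : ((((β : SL(2, ℤ)) 1 1 : ℤ) : ZMod N)) = -((((β' : SL(2, ℤ)) 1 1 : ℤ) : ZMod N))) :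
    χ β = χ β' :=
  chi_eq_of_b_neg_one_of_d_eq_neg_of_four hN hadd hsmall hkill
    (fun _ _ hb₁ hb₂ e ↦ chi_eq_of_b_neg_one_of_d_eq_four_mul_odd hN hadd hsmall hkill hb₁ hb₂ e) hb hb' h

/-- **`F(1/u) = F(u)` at every odd level.** For `b = −1` elements of `Γ₀(N)`, `N` odd, with `d(β) d(β') ≡ 1 (mod N)`: `χ β = χ β'`.
[cite: Pollack2003, Conj. 6.3] -/
theorem chi_eq_of_b_neg_one_of_mul_d_eq_one_odd (hN : Odd N)
    (hadd : ∀ γ δ : Gamma0 N, χ (γ * δ) = χ γ + χ δ)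
    (hsmall : ∀ γ : Gamma0 N, ((γ : SL(2, ℤ)) 0 0 + (γ : SL(2, ℤ)) 1 1).natAbs ≤ 2 → χ γ = 0)
    (hkill : ∀ γ : Gamma0 N, (∃ k : ℕ, 1 ≤ k ∧ ((γ : SL(2, ℤ)) 1 1).natAbs = 4 ^ k) → χ γ = 0)
    {β β' : Gamma0 N} (hb : (β : SL(2, ℤ)) 0 1 = -1) (hb' : (β' : SL(2, ℤ)) 0 1 = -1)
    (h : ((((β : SL(2, ℤ)) 1 1 : ℤ) : ZMod N)) * ((((β' : SL(2, ℤ)) 1 1 : ℤ) : ZMod N)) = 1) :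
    χ β = χ β' :=
  chi_eq_of_b_neg_one_of_mul_d_eq_one_of_four hN hadd hsmall hkill
    (fun _ _ hb₁ hb₂ e ↦ chi_eq_of_b_neg_one_of_d_eq_four_mul_odd hN hadd hsmall hkill hb₁ hb₂ e) hb hb' h

/-- `E(r, s)` from `r = −s` at every odd level (`K/E` form). [cite: Pollack2003, Conj. 6.3] -/
theorem E_of_eq_neg_odd (hN : Odd N) (hadd : ∀ γ δ : Gamma0 N, χ (γ * δ) = χ γ + χ δ)
    (hsmall : ∀ γ : Gamma0 N, ((γ : SL(2, ℤ)) 0 0 + (γ : SL(2, ℤ)) 1 1).natAbs ≤ 2 → χ γ = 0)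
    (hkill : ∀ γ : Gamma0 N, (∃ k : ℕ, 1 ≤ k ∧ ((γ : SL(2, ℤ)) 1 1).natAbs = 4 ^ k) → χ γ = 0)
    (r s : ZMod N) (h : r = -s) :
    ∀ β β' : Gamma0 N, (β : SL(2, ℤ)) 0 1 = -1 → (β' : SL(2, ℤ)) 0 1 = -1 →
      ((((β : SL(2, ℤ)) 1 1 : ℤ) : ZMod N)) = r → ((((β' : SL(2, ℤ)) 1 1 : ℤ) : ZMod N)) = s → χ β = χ β' :=
  fun _ _ hb hb' hd hd' ↦ chi_eq_of_b_neg_one_of_d_eq_neg_odd hN hadd hsmall hkill hb hb' (by rw [hd, hd', h])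

/-- `E(r, s)` from `r s = 1` at every odd level (`K/E` form). [cite: Pollack2003, Conj. 6.3] -/
theorem E_of_mul_eq_one_odd (hN : Odd N) (hadd : ∀ γ δ : Gamma0 N, χ (γ * δ) = χ γ + χ δ)
    (hsmall : ∀ γ : Gamma0 N, ((γ : SL(2, ℤ)) 0 0 + (γ : SL(2, ℤ)) 1 1).natAbs ≤ 2 → χ γ = 0)
    (hkill : ∀ γ : Gamma0 N, (∃ k : ℕ, 1 ≤ k ∧ ((γ : SL(2, ℤ)) 1 1).natAbs = 4 ^ k) → χ γ = 0)
    (r s : ZMod N) (h : r * s = 1) :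
    ∀ β β' : Gamma0 N, (β : SL(2, ℤ)) 0 1 = -1 → (β' : SL(2, ℤ)) 0 1 = -1 →
      ((((β : SL(2, ℤ)) 1 1 : ℤ) : ZMod N)) = r → ((((β' : SL(2, ℤ)) 1 1 : ℤ) : ZMod N)) = s → χ β = χ β' :=
  fun _ _ hb hb' hd hd' ↦ chi_eq_of_b_neg_one_of_mul_d_eq_one_odd hN hadd hsmall hkill hb hb' (by rw [hd, hd', h])

/-- Transport `K(r) → K(4r)` at every odd level. [cite: Pollack2003, Conj. 6.3] -/
theorem K_of_K_four_odd (hN : Odd N) (hadd : ∀ γ δ : Gamma0 N, χ (γ * δ) = χ γ + χ δ)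
    (hsmall : ∀ γ : Gamma0 N, ((γ : SL(2, ℤ)) 0 0 + (γ : SL(2, ℤ)) 1 1).natAbs ≤ 2 → χ γ = 0)
    (hkill : ∀ γ : Gamma0 N, (∃ k : ℕ, 1 ≤ k ∧ ((γ : SL(2, ℤ)) 1 1).natAbs = 4 ^ k) → χ γ = 0)
    (r s : ZMod N) (h : s = 4 * r) :
    (∀ β : Gamma0 N, (β : SL(2, ℤ)) 0 1 = -1 → ((((β : SL(2, ℤ)) 1 1 : ℤ) : ZMod N)) = r → χ β = 0) →
    ∀ β : Gamma0 N, (β : SL(2, ℤ)) 0 1 = -1 → ((((β : SL(2, ℤ)) 1 1 : ℤ) : ZMod N)) = s → χ β = 0 := by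
  haveI : NeZero N := ⟨hN.pos.ne'⟩
  intro K β' hb' hd'
  have hs : IsUnit s := hd' ▸ isUnit_gamma0_apply_one_one β'
  have hr : IsUnit r := by rw [h] at hs; exact isUnit_of_mul_isUnit_right hs
  obtain ⟨β, hb, hd⟩ := exists_b_neg_one_of_isUnit (N := N) hr
  rw [chi_eq_of_b_neg_one_of_d_eq_four_mul_odd hN hadd hsmall hkill hb' hb (by rw [hd, hd', h]), K β hb hd]

/-- Transport `K(4s) → K(s)` at every odd level. [cite: Pollack2003, Conj. 6.3] -/
theorem K_of_K_four'_odd (hN : Odd N) (hadd : ∀ γ δ : Gamma0 N, χ (γ * δ) = χ γ + χ δ)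
    (hsmall : ∀ γ : Gamma0 N, ((γ : SL(2, ℤ)) 0 0 + (γ : SL(2, ℤ)) 1 1).natAbs ≤ 2 → χ γ = 0)
    (hkill : ∀ γ : Gamma0 N, (∃ k : ℕ, 1 ≤ k ∧ ((γ : SL(2, ℤ)) 1 1).natAbs = 4 ^ k) → χ γ = 0)
    (r s : ZMod N) (h : r = 4 * s) :
    (∀ β : Gamma0 N, (β : SL(2, ℤ)) 0 1 = -1 → ((((β : SL(2, ℤ)) 1 1 : ℤ) : ZMod N)) = r → χ β = 0) →
    ∀ β : Gamma0 N, (β : SL(2, ℤ)) 0 1 = -1 → ((((β : SL(2, ℤ)) 1 1 : ℤ) : ZMod N)) = s → χ β = 0 := by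
  haveI : NeZero N := ⟨hN.pos.ne'⟩
  intro K β' hb' hd'
  have hs : IsUnit s := hd' ▸ isUnit_gamma0_apply_one_one β'
  have hr : IsUnit r := h ▸ (isUnit_four_zmod hN).mul hs
  obtain ⟨β, hb, hd⟩ := exists_b_neg_one_of_isUnit (N := N) hr
  rw [← chi_eq_of_b_neg_one_of_d_eq_four_mul_odd hN hadd hsmall hkill hb hb' (by rw [hd, hd', h]), K β hb hd]

/-- Transport `K(r) → K(−r)` at every odd level. [cite: Pollack2003, Conj. 6.3] -/
theorem K_of_K_neg_odd (hN : Odd N) (hadd : ∀ γ δ : Gamma0 N, χ (γ * δ) = χ γ + χ δ)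
    (hsmall : ∀ γ : Gamma0 N, ((γ : SL(2, ℤ)) 0 0 + (γ : SL(2, ℤ)) 1 1).natAbs ≤ 2 → χ γ = 0)
    (hkill : ∀ γ : Gamma0 N, (∃ k : ℕ, 1 ≤ k ∧ ((γ : SL(2, ℤ)) 1 1).natAbs = 4 ^ k) → χ γ = 0)
    (r s : ZMod N) (h : s = -r) :
    (∀ β : Gamma0 N, (β : SL(2, ℤ)) 0 1 = -1 → ((((β : SL(2, ℤ)) 1 1 : ℤ) : ZMod N)) = r → χ β = 0) →
    ∀ β : Gamma0 N, (β : SL(2, ℤ)) 0 1 = -1 → ((((β : SL(2, ℤ)) 1 1 : ℤ) : ZMod N)) = s → χ β = 0 := by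
  haveI : NeZero N := ⟨hN.pos.ne'⟩
  intro K β' hb' hd'
  have hs : IsUnit s := hd' ▸ isUnit_gamma0_apply_one_one β'
  have hr : IsUnit r := by rw [h] at hs; simpa using hs.neg
  obtain ⟨β, hb, hd⟩ := exists_b_neg_one_of_isUnit (N := N) hr
  rw [chi_eq_of_b_neg_one_of_d_eq_neg_odd hN hadd hsmall hkill hb' hb (by rw [hd, hd', h]), K β hb hd]

/-- Transport `K(r) → K(s)` for `r s = 1` at every odd level. [cite: Pollack2003, Conj. 6.3] -/
theorem K_of_K_inv_odd (hN : Odd N) (hadd : ∀ γ δ : Gamma0 N, χ (γ * δ) = χ γ + χ δ)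
    (hsmall : ∀ γ : Gamma0 N, ((γ : SL(2, ℤ)) 0 0 + (γ : SL(2, ℤ)) 1 1).natAbs ≤ 2 → χ γ = 0)
    (hkill : ∀ γ : Gamma0 N, (∃ k : ℕ, 1 ≤ k ∧ ((γ : SL(2, ℤ)) 1 1).natAbs = 4 ^ k) → χ γ = 0)
    (r s : ZMod N) (h : r * s = 1) :
    (∀ β : Gamma0 N, (β : SL(2, ℤ)) 0 1 = -1 → ((((β : SL(2, ℤ)) 1 1 : ℤ) : ZMod N)) = r → χ β = 0) →
    ∀ β : Gamma0 N, (β : SL(2, ℤ)) 0 1 = -1 → ((((β : SL(2, ℤ)) 1 1 : ℤ) : ZMod N)) = s → χ β = 0 := by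
  haveI : NeZero N := ⟨hN.pos.ne'⟩
  intro K β' hb' hd'
  have hr : IsUnit r := IsUnit.of_mul_eq_one s h
  obtain ⟨β, hb, hd⟩ := exists_b_neg_one_of_isUnit (N := N) hr
  rw [← chi_eq_of_b_neg_one_of_mul_d_eq_one_odd hN hadd hsmall hkill hb hb' (by rw [hd, hd', h]), K β hb hd]

end SignOdd

end Summit.BirchSwinnertonDyer.BirchSwinnertonDyer.Theorems.SignedMuAtTwo
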